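import Mathlib.Data.Sym.Card
import Mathlib.Data.Finsupp.Multiset
import Literature.AlgebraicGeometry.Motives.GeneratingSectionsToProjRatios
import HarnessLib

/-!
# The Veronese (`d`-uple) embedding `ℙ(ι)_k ↪ ℙ(M_d)_k` over a commutative ring

Topic `Literature/AlgebraicGeometry/Motives`; sibling of `Motives/FormsEmbedding` (re-embedding by
forms of one degree) and `Motives/SegreEmbedding`. Let `k` be a commutative ring, `ι` an index
type, `d ≥ 1`, and `M_d(ι) = {μ : ι →₀ ℕ | |μ| = d}` the set of monomials `x^μ` of degree `d` in
`k[xᵢ : i ∈ ι]`. Hartshorne, *Algebraic Geometry*, II Ex. 5.13 ("the `d`-uple embedding"; I Ex.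
2.12: "`ρ_d : 𝐏ⁿ → 𝐏ᴺ`, `N = (n+d choose n) − 1`, sending `(a₀, …, aₙ)` to the tuple of all
monomials of degree `d`") and Görtz–Wedhorn I (13.12) / Prop. 13.56 describe the morphism
`v_d : ℙ(ι)_k → ℙ(M_d(ι))_k` defined by the generating sections `x^μ` of `𝒪(d)`, and prove it is a
closed immersion (`𝒪(d)` is very ample).

Mathlib has no invertible sheaves on schemes; as in the sibling files the construction is carried
out in the chart form of Hartshorne II Thm. 7.1 (`Literature.AlgebraicGeometry.Motives.GeneratingSections`,
`Motives/MorphismsToProjectiveSpace`), and — at no extra cost — for an arbitrary `k`-morphism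
`r : Y → ℙ(ι)_k` in place of the identity: the sections `r^*(x^μ)`, `|μ| = d`, of `r^*𝒪(d)` have
no common zero, hence define the **`d`-uple re-embedding** `veroneseMap : Y → ℙ(M)_k` for any
labelling `e : M ≃ M_d(ι)` of the target coordinates; for `r = 𝟙` this is the Veronese map
`veronese k ι d e : ℙ(ι)_k → ℙ(M)_k`.

## Main definitions and results (all proved; no named facts)

* `GeneratingSections.Sec.monomialFinsupp D μ` — the section `s^μ = ∏ sᵢ^{⊗μᵢ}` of `𝓛^{⊗|μ|}` in chart
  form (`val j = ∏ᵢ (sᵢ/s_j)^{μ i}`), for any generating-sections data `D`.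
* `GeneratingSections.Md ι d` — the index type `{μ : ι →₀ ℕ // μ.degree = d}` of degree-`d`
  monomials; `Md.single i` = `x_i^d`; `MdEquivSym : Md ι d ≃ Sym ι d`;
  `card_Md : Fintype.card (Md (Fin (n + 1)) d) = (n + d).choose d` (so `ℙ(M_d(Fin (n+1)))` is
  `ℙ^{(n+d choose d) − 1}`), `nonempty_fin_equiv_Md`.
* `GeneratingSections.veroneseData r hd : GeneratingSections (Md ι d) Y` — the data of the
  sections `r^*(x^μ)` (`GeneratingSections.ofSections`), `veroneseData_U_single :
  U (x_i^d) = r⁻¹D₊(xᵢ)`, `veroneseData_ratio_single : (x^μ)/(x_i^d) ↦ r^*(x^μ/x_i^d)`.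
* `GeneratingSections.veroneseMap f r hd e : Y ⟶ Proj k[z_m : m ∈ M]`, over `k`
  (`veroneseMap_toSpec`), with `veroneseMap⁻¹D₊(z_{x_i^d}) = r⁻¹D₊(xᵢ)`
  (`veroneseMap_preimage_basicOpen_of_eq_single`) and
  `veroneseMap^*(z_μ/z_{x_i^d}) = r^*(x^μ/x_i^d)` (`homRatio_veroneseMap_of_eq_single`);
  **`isClosedImmersion_veroneseMap`**: a closed immersion when `r` is and `ι` is finite
  (Hartshorne II Prop. 7.2 over the charts `D₊(z_{x_i^d})`, image closed by properness — verbatim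
  the argument of `GeneratingSections.isClosedImmersion_formsMap`).
* `Veronese.veronese k ι d e : Proj k[x_ι] ⟶ Proj k[z_M]` — **the Veronese embedding**,
  `veronese_toSpec`, `veronese_preimage_basicOpen_of_eq_single : v_d⁻¹D₊(z_{x_i^d}) = D₊(xᵢ)`,
  **`isClosedImmersion_veronese`** (Hartshorne II Ex. 5.13).

Base-change to projective space over an arbitrary base scheme (`Morphisms.projectiveSpace ι S`)
is done in `Morphisms/ProjectiveSpaceSegreVeronese`.

## References

* R. Hartshorne, *Algebraic Geometry*, GTM 52 (1977): I Ex. 2.12, II Ex. 5.13, II Thm. 7.1,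
  II Prop. 7.2. [Hartshorne1977]
* U. Görtz, T. Wedhorn, *Algebraic Geometry I: Schemes*, 2nd ed. (2020): (13.12) "The Veronese
  embedding", Prop. 13.56. [GortzWedhorn2020]
-/

universe u

open CategoryTheory AlgebraicGeometry Limits HomogeneousLocalization TopologicalSpace Opposite
open MvPolynomial (X C eval₂Hom eval₂)
open Literature.AlgebraicGeometry.Motives.Segre

attribute [local instance] MvPolynomial.gradedAlgebra

noncomputable section

namespace Literature.AlgebraicGeometry.Motives

namespace GeneratingSections

/-! ### Monomial sections `s^μ` of `𝓛^{⊗|μ|}` -/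

section Monomial

variable {ι : Type} {Y : Scheme.{u}} (D : GeneratingSections ι Y)

/-- **The monomial section** `s^μ = ⊗ᵢ sᵢ^{⊗μᵢ} ∈ Γ(Y, 𝓛^{⊗|μ|})` in chart form: its `j`-th chart
value is `∏ᵢ (sᵢ/s_j)^{μ i}` ("`x^μ / x_j^{|μ|}`"), for a finitely supported exponent
`μ : ι →₀ ℕ` (the tree's `GeneratingSections.Sec.monomial` of `Motives/ProjectiveDescentSections`
is the same for `ι` a `Fintype` and `μ : ι → ℕ`). [cite: Hartshorne1977, II Thm. 7.1 (b)] -/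
def Sec.monomialFinsupp (μ : ι →₀ ℕ) : D.Sec μ.degree where
  val j := μ.prod fun i n ↦ D.ratio j i ^ n
  compat i j := by
    simp only [Finsupp.prod, map_prod, map_pow, Finsupp.degree_apply]
    rw [← Finset.prod_pow_eq_pow_sum, ← Finset.prod_mul_distrib]
    refine Finset.prod_congr rfl fun l _ ↦ ?_
    rw [D.ratio_right_eq i j l, mul_pow, mul_comm]

/-- The chart values of a monomial section. [cite: Hartshorne1977, II Thm. 7.1 (b)] -/
@[simp] theorem Sec.monomialFinsupp_val (μ : ι →₀ ℕ) (j : ι) :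
    (Sec.monomialFinsupp D μ).val j = μ.prod fun i n ↦ D.ratio j i ^ n := rfl

/-- `s^{d eᵢ} = sᵢ^{⊗d}`: chart values `(sᵢ/s_j)^d`. [cite: Hartshorne1977, II Thm. 7.1 (b)] -/
theorem Sec.monomialFinsupp_val_single (i : ι) (d : ℕ) (j : ι) :
    (Sec.monomialFinsupp D (Finsupp.single i d)).val j = D.ratio j i ^ d :=
  Finsupp.prod_single_index (h := fun l n ↦ D.ratio j l ^ n) (pow_zero _)

/-- `s^{μ + ν} = s^μ ⊗ s^ν` on chart values. [cite: Hartshorne1977, II Thm. 7.1 (b)] -/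
theorem Sec.monomialFinsupp_val_add (μ ν : ι →₀ ℕ) (j : ι) :
    (Sec.monomialFinsupp D (μ + ν)).val j = (Sec.monomialFinsupp D μ).val j * (Sec.monomialFinsupp D ν).val j := by
  simp only [Sec.monomialFinsupp_val]
  exact Finsupp.prod_add_index' (fun _ ↦ pow_zero _) fun _ _ _ ↦ pow_add _ _ _

/-- On its own chart a factor `(s_j/s_j)^{μ j}` is `1`: the `j`-th value of `s^μ` only sees the
indices `i ≠ j`; in particular the `i`-th value of `s^{d eᵢ}` is `1`. [cite: Hartshorne1977, II Thm. 7.1 (b)] -/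
theorem Sec.monomialFinsupp_val_single_self (i : ι) (d : ℕ) :
    (Sec.monomialFinsupp D (Finsupp.single i d)).val i = 1 := by
  rw [Sec.monomialFinsupp_val_single, D.ratio_self, one_pow]

/-- The value of `s^μ` on a chart `j` is a multiple of `(s_i/s_j)^{μ i}` for each `i`; hence its
non-vanishing locus lies in `U i` whenever `μ i ≠ 0`. [cite: Hartshorne1977, II Thm. 7.1 (b)] -/
theorem Sec.basicOpen_monomialFinsupp_val_le (μ : ι →₀ ℕ) {i : ι} (hi : i ∈ μ.support) (j : ι) :
    Y.basicOpen ((Sec.monomialFinsupp D μ).val j) ≤ D.U i := by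
  classical
  rw [Sec.monomialFinsupp_val, Finsupp.prod, ← Finset.mul_prod_erase _ _ hi, Y.basicOpen_mul,
    Y.basicOpen_pow _ (Nat.pos_of_ne_zero (Finsupp.mem_support_iff.mp hi))]
  exact inf_le_left.trans (D.V_le_right j i)

end Monomial

/-! ### The index type `M_d(ι)` of degree-`d` monomials -/

section Index

/-- The set `M_d(ι) = {μ : ι →₀ ℕ | |μ| = d}` of (exponents of) monomials of degree `d` in the
variables `xᵢ`, `i ∈ ι` — the homogeneous coordinates of the target of the `d`-uple embedding.
[cite: Hartshorne1977, I Ex. 2.12] -/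
def Md (ι : Type) (d : ℕ) : Type := {μ : ι →₀ ℕ // μ.degree = d}

variable {ι : Type} {d : ℕ}

/-- The exponent `d eᵢ` of the pure power `x_i^d`. [cite: Hartshorne1977, I Ex. 2.12] -/
def Md.single (i : ι) : Md ι d := ⟨Finsupp.single i d, Finsupp.degree_single i d⟩

/-- The underlying exponent of `Md.single i` is `d eᵢ` (the monomial `x_i^d`). [cite: Hartshorne1977, I Ex. 2.12] -/
@[simp] theorem Md.single_val (i : ι) : (Md.single i : Md ι d).1 = Finsupp.single i d := rfl

/-- The exponent `(d-1) eᵢ + e_{i'}` of the monomial `x_i^{d-1} x_{i'}` (for `d ≥ 1`).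
[cite: Hartshorne1977, I Ex. 2.12] -/
def Md.singleMul (hd : 0 < d) (i i' : ι) : Md ι d :=
  ⟨Finsupp.single i (d - 1) + Finsupp.single i' 1, by
    rw [map_add, Finsupp.degree_single, Finsupp.degree_single, Nat.sub_add_cancel hd]⟩

/-- The underlying exponent of `Md.singleMul hd i i'` (the monomial `x_i^{d-1} x_{i'}`). [cite: Hartshorne1977, I Ex. 2.12] -/
@[simp] theorem Md.singleMul_val (hd : 0 < d) (i i' : ι) :
    (Md.singleMul hd i i' : Md ι d).1 = Finsupp.single i (d - 1) + Finsupp.single i' 1 := rfl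

/-- A monomial of positive degree involves some variable. [cite: Hartshorne1977, I Ex. 2.12] -/
theorem Md.support_nonempty (hd : 0 < d) (μ : Md ι d) : μ.1.support.Nonempty := by
  rw [Finsupp.support_nonempty_iff]
  intro h
  have h0 : μ.1.degree = 0 := by rw [h, map_zero]
  rw [μ.2] at h0
  exact hd.ne' h0

/-- **A chosen "home" variable of a monomial of positive degree**: some `i` with `μ i ≠ 0` (so
that `D₊(x^μ) ⊆ D₊(xᵢ)`). [folklore] -/
def Md.home (hd : 0 < d) (μ : Md ι d) : ι := (Md.support_nonempty hd μ).choose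

/-- The home variable occurs in the monomial (`D₊(x^μ) ⊆ D₊(x_{home μ})`). [cite: Hartshorne1977, I Ex. 2.12] -/
theorem Md.home_mem (hd : 0 < d) (μ : Md ι d) : Md.home hd μ ∈ μ.1.support :=
  (Md.support_nonempty hd μ).choose_spec

/-- The home variable of `x_i^d` is `i`. [cite: Hartshorne1977, I Ex. 2.12] -/
theorem Md.home_single (hd : 0 < d) (i : ι) : Md.home hd (Md.single i : Md ι d) = i := by
  have h := Md.home_mem hd (Md.single i : Md ι d)
  rw [Md.single_val, Finsupp.support_single _ hd.ne', Finset.mem_singleton] at h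
  exact h

/-- The degree of an exponent vector is the cardinality of the corresponding multiset of
variables. [folklore] -/
private theorem degree_eq_card_toMultiset (μ : ι →₀ ℕ) :
    μ.degree = Multiset.card (Finsupp.toMultiset μ) := by
  rw [Finsupp.card_toMultiset, Finsupp.degree_apply]
  rfl

/-- `M_d(ι) ≃ Sym ι d`: a monomial of degree `d` is a multiset of `d` variables
(`Multiset.toFinsupp`). [folklore] -/
def MdEquivSym [DecidableEq ι] : Md ι d ≃ Sym ι d :=
  (Equiv.subtypeEquiv Multiset.toFinsupp.toEquiv fun s ↦ by
    change Multiset.card s = d ↔ Finsupp.degree (Multiset.toFinsupp s) = d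
    rw [degree_eq_card_toMultiset, Multiset.toFinsupp_toMultiset]).symm

/-- `M_d(ι)` is finite for `ι` finite. [folklore] -/
instance Md.finite [Finite ι] : Finite (Md ι d) := by
  classical
  haveI := Fintype.ofFinite ι
  exact Finite.of_equiv _ MdEquivSym.symm

/-- **`#M_d(Fin (n+1)) = (n+d choose d)`**: the target of the `d`-uple embedding of `ℙⁿ` is
`ℙᴺ` with `N + 1 = (n+d choose d)` (Hartshorne I Ex. 2.12: "`N = (n+d choose n) − 1`").
[cite: Hartshorne1977, I Ex. 2.12] -/
theorem card_Md (n d : ℕ) [Fintype (Md (Fin (n + 1)) d)] :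
    Fintype.card (Md (Fin (n + 1)) d) = (n + d).choose d := by
  rw [Fintype.card_congr (MdEquivSym (ι := Fin (n + 1)) (d := d)), Sym.card_sym_eq_choose,
    Fintype.card_fin, Nat.add_right_comm, Nat.add_sub_cancel]

/-- A labelling of the degree-`d` monomials in `n + 1` variables by `Fin (n+d choose d)` exists.
[cite: Hartshorne1977, I Ex. 2.12] -/
theorem nonempty_fin_equiv_Md (n d : ℕ) : Nonempty (Fin ((n + d).choose d) ≃ Md (Fin (n + 1)) d) := by
  classical
  haveI : Fintype (Md (Fin (n + 1)) d) := Fintype.ofFinite _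
  exact ⟨(Fintype.equivFinOfCardEq (card_Md n d)).symm⟩

end Index

/-! ### The sections `r^*(x^μ)`, `|μ| = d`, and their generating-sections data -/

section Veronese

variable {ι : Type} {k : Type u} [CommRing k] {Y : Scheme.{u}} (f : Y ⟶ Spec (.of k))
  (r : Y ⟶ Proj (grading ι k)) {d : ℕ} (hd : 0 < d)

/-- **The sections defining the `d`-uple re-embedding**: `σ_μ = r^*(x^μ) ∈ Γ(Y, r^*𝒪(d))`,
`|μ| = d`, in chart form. [cite: Hartshorne1977, II Thm. 7.1 (b)] -/
def veroneseSec (μ : Md ι d) : (ofHom r).Sec d :=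
  (Sec.monomialFinsupp (ofHom r) μ.1).cast μ.2

/-- The chart values of `σ_μ`: `∏ᵢ r^*(xᵢ/x_j)^{μ i} = r^*(x^μ/x_j^d)`. [cite: Hartshorne1977, II Thm. 7.1 (b)] -/
@[simp] theorem veroneseSec_val (μ : Md ι d) (j : ι) :
    (veroneseSec r μ).val j = μ.1.prod fun i n ↦ (ofHom r).ratio j i ^ n := rfl

/-- `σ_{d eᵢ} = x_i^d` has value `1` on the chart `i`. [cite: Hartshorne1977, II Thm. 7.1 (b)] -/
theorem veroneseSec_single_val_self (i : ι) : (veroneseSec r (Md.single i : Md ι d)).val i = 1 := by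
  rw [veroneseSec, Sec.cast_val, Md.single_val, Sec.monomialFinsupp_val_single_self]

/-- `σ_{d eᵢ}` has value `1` on its home chart (which is `i`). [cite: Hartshorne1977, II Thm. 7.1 (b)] -/
theorem veroneseSec_single_val_home (i : ι) :
    (veroneseSec r (Md.single i : Md ι d)).val (Md.home hd (Md.single i)) = 1 := by
  have key : ∀ x, x = i → (veroneseSec r (Md.single i : Md ι d)).val x = 1 := by
    intro x hx
    rw [hx]
    exact veroneseSec_single_val_self r i
  exact key _ (Md.home_single hd i)

/-- `σ_{(d-1)eᵢ + e_{i'}} = x_i^{d-1} x_{i'}` has value `r^*(x_{i'}/xᵢ)` on the chart `i`.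
[cite: Hartshorne1977, II Thm. 7.1 (b)] -/
theorem veroneseSec_singleMul_val_self (i i' : ι) :
    (veroneseSec r (Md.singleMul hd i i')).val i = (ofHom r).ratio i i' := by
  rw [veroneseSec, Sec.cast_val, Md.singleMul_val, Sec.monomialFinsupp_val_add,
    Sec.monomialFinsupp_val_single_self, Sec.monomialFinsupp_val_single, one_mul, pow_one]

/-- Each `σ_μ` is supported in its home chart: `Y_{σ_μ} ⊆ r⁻¹D₊(x_{home μ})` (the factor
`x_{home μ}^{μ(home μ)}` with positive exponent). [cite: Hartshorne1977, II Thm. 7.1 (b)] -/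
theorem veroneseSec_home (μ : Md ι d) (j : ι) :
    Y.basicOpen ((veroneseSec r μ).val j) ≤ (ofHom r).U (Md.home hd μ) := by
  rw [veroneseSec, Sec.cast_val]
  exact Sec.basicOpen_monomialFinsupp_val_le (ofHom r) μ.1 (Md.home_mem hd μ) j

/-- The non-vanishing locus of `σ_{d eᵢ} = x_i^d`, read on its home chart, is the whole chart
`r⁻¹D₊(xᵢ)`. [cite: Hartshorne1977, II Thm. 7.1 (b)] -/
theorem basicOpen_veroneseSec_single (i : ι) :
    Y.basicOpen ((veroneseSec r (Md.single i : Md ι d)).val (Md.home hd (Md.single i))) =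
      (ofHom r).U i := by
  have key : ∀ x, x = i →
      Y.basicOpen ((veroneseSec r (Md.single i : Md ι d)).val x) = (ofHom r).U i := by
    intro x hx
    rw [hx, veroneseSec_single_val_self, Y.basicOpen_one]
  exact key _ (Md.home_single hd i)

/-- The `σ_μ` have no common zero (already the `x_i^d` do not). [cite: Hartshorne1977, II Thm. 7.1 (b)] -/
theorem iSup_basicOpen_veroneseSec :
    ⨆ μ : Md ι d, Y.basicOpen ((veroneseSec r μ).val (Md.home hd μ)) = ⊤ := by
  rw [← top_le_iff, ← (ofHom r).iSup_U, iSup_le_iff]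
  intro i
  rw [← basicOpen_veroneseSec_single r hd i]
  exact le_iSup (fun μ : Md ι d ↦ Y.basicOpen ((veroneseSec r μ).val (Md.home hd μ))) (Md.single i)

/-- **The generating-sections data of the `d`-uple re-embedding** (`GeneratingSections.ofSections`
of the `σ_μ = r^*(x^μ)`, `|μ| = d`): opens `Y_{σ_μ}`, ratios `σ_{μ'}/σ_μ`. [cite: Hartshorne1977, II Thm. 7.1 (b)] -/
def veroneseData : GeneratingSections (Md ι d) Y :=
  (ofHom r).ofSections (Md.home hd) (veroneseSec r) (veroneseSec_home r hd)
    (iSup_basicOpen_veroneseSec r hd)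

/-- The opens of `veroneseData` are the `Y_{σ_μ}` (basic opens of the home charts).
[cite: Hartshorne1977, II Thm. 7.1 (b)] -/
theorem veroneseData_U (μ : Md ι d) :
    (veroneseData r hd).U μ = Y.basicOpen ((veroneseSec r μ).val (Md.home hd μ)) := rfl

/-- The chart of `x_i^d` is the chart `U i` of `ofHom r`. [cite: Hartshorne1977, II Thm. 7.1 (b)] -/
theorem veroneseData_U_single' (i : ι) : (veroneseData r hd).U (Md.single i) = (ofHom r).U i :=
  basicOpen_veroneseSec_single r hd i

/-- **The chart of `x_i^d` is `r⁻¹D₊(xᵢ)`.** [cite: Hartshorne1977, II Thm. 7.1 (b)] -/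
theorem veroneseData_U_single (i : ι) :
    (veroneseData r hd).U (Md.single i) = r ⁻¹ᵁ Proj.basicOpen (grading ι k) (X i) :=
  basicOpen_veroneseSec_single r hd i

/-- All the charts of `veroneseData` are affine when `r` is an affine morphism (basic opens of the
affine `r⁻¹D₊(xᵢ)`). [cite: Hartshorne1977, II Thm. 7.1 (b)] -/
theorem isAffineOpen_veroneseData_U [IsAffineHom r] (μ : Md ι d) :
    IsAffineOpen ((veroneseData r hd).U μ) :=
  (isAffineOpen_ofHom_U r (Md.home hd μ)).basicOpen _

/-- The ratios at a chart `μ` whose section has home value `1`: `σ_{μ'}/σ_μ` is the home-chart value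
of `σ_{μ'}`, restricted. [cite: Hartshorne1977, II Thm. 7.1 (b)] -/
theorem veroneseData_ratio_of_val_home_eq_one (μ : Md ι d)
    (hμ : (veroneseSec r μ).val (Md.home hd μ) = 1) (μ' : Md ι d) :
    (veroneseData r hd).ratio μ μ' =
      rs (Y.basicOpen_le _) ((veroneseSec r μ').val (Md.home hd μ)) := by
  have h := (ofHom r).ratio'_mul_num (Md.home hd) (veroneseSec r) μ μ'
  rw [num, hμ, map_one, mul_one] at h
  exact h

/-- **The ratios at the chart of `x_i^d`**: `σ_{μ'}/x_i^d` is the chart-`i` value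
`r^*(x^{μ'}/x_i^d)` of `σ_{μ'}` (restricted along `Y_{x_i^d} = r⁻¹D₊(xᵢ)`). [cite: Hartshorne1977, II Thm. 7.1 (b)] -/
theorem veroneseData_ratio_single (i : ι) (μ' : Md ι d) :
    (veroneseData r hd).ratio (Md.single i) μ' =
      rs (veroneseData_U_single' r hd i).le ((veroneseSec r μ').val i) := by
  rw [veroneseData_ratio_of_val_home_eq_one r hd (Md.single i) (veroneseSec_single_val_home r hd i)]
  have key : ∀ x (hx : (veroneseData r hd).U (Md.single i) ≤ (ofHom r).U x), x = i →
      rs hx ((veroneseSec r μ').val x) =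
        rs (veroneseData_U_single' r hd i).le ((veroneseSec r μ').val i) := by
    rintro _ _ rfl
    rfl
  exact key _ _ (Md.home_single hd i)

/-- In particular `(x_i^{d-1} x_{i'})/x_i^d` pulls back to `r^*(x_{i'}/xᵢ)`. [cite: Hartshorne1977, II Thm. 7.1 (b)] -/
theorem veroneseData_ratio_single_singleMul (i i' : ι) :
    (veroneseData r hd).ratio (Md.single i) (Md.singleMul hd i i') =
      rs (veroneseData_U_single' r hd i).le ((ofHom r).ratio i i') := by
  rw [veroneseData_ratio_single, veroneseSec_singleMul_val_self]

/-- The constants of the chart of `x_i^d` are those of `r⁻¹D₊(xᵢ)`. [cite: Hartshorne1977, II Thm. 7.1 (b)] -/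
theorem veroneseData_cstr_single (i : ι) (c : k) :
    (veroneseData r hd).cstr f (Md.single i) c =
      rs (veroneseData_U_single' r hd i).le ((ofHom r).cstr f i c) := by
  change rs _ (pull f c) = rs _ (rs _ (pull f c))
  rw [rs_rs]

/-- **Surjectivity at the charts of the pure powers** (hypothesis (2) of Hartshorne II Prop. 7.2
for the charts `D₊(z_{x_i^d})`): for a closed immersion `r`, `Γ(Y, Y_{x_i^d}) = Γ(Y, r⁻¹D₊(xᵢ))` is
generated by the constants and the ratios `z_{μ'}/z_{x_i^d}` — already by the
`(x_i^{d-1}x_{i'})/x_i^d = r^*(x_{i'}/xᵢ)`. [cite: Hartshorne1977, II Prop. 7.2] -/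
theorem closure_veroneseData_single (hr : r ≫ toSpec ι k = f) [IsClosedImmersion r] (i : ι) :
    Subring.closure (Set.range ((veroneseData r hd).cstr f (Md.single i)) ∪
      Set.range ((veroneseData r hd).ratio (Md.single i))) = ⊤ := by
  set θ : Γ(Y, (ofHom r).U i) →+* Γ(Y, (veroneseData r hd).U (Md.single i)) :=
    rs (veroneseData_U_single' r hd i).le with hθ
  have hθsurj : Function.Surjective θ := by
    intro s
    refine ⟨rs (veroneseData_U_single' r hd i).symm.le s, ?_⟩
    rw [hθ, rs_rs, rs_refl]
  have hsub : θ '' (Set.range ((ofHom r).cstr f i) ∪ Set.range ((ofHom r).ratio i)) ⊆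
      Set.range ((veroneseData r hd).cstr f (Md.single i)) ∪
        Set.range ((veroneseData r hd).ratio (Md.single i)) := by
    rintro _ ⟨s, hs | hs, rfl⟩
    · obtain ⟨c, rfl⟩ := hs
      exact Or.inl ⟨c, veroneseData_cstr_single f r hd i c⟩
    · obtain ⟨i', rfl⟩ := hs
      exact Or.inr ⟨Md.singleMul hd i i', veroneseData_ratio_single_singleMul r hd i i'⟩
  rw [← top_le_iff]
  calc (⊤ : Subring _) = θ.range := (RingHom.range_eq_top.mpr hθsurj).symm
    _ = (Subring.closure (Set.range ((ofHom r).cstr f i) ∪ Set.range ((ofHom r).ratio i))).map θ := by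
        rw [closure_ofHom_eq_top f r hr i, ← RingHom.range_eq_map]
    _ = Subring.closure (θ '' (Set.range ((ofHom r).cstr f i) ∪ Set.range ((ofHom r).ratio i))) :=
        RingHom.map_closure _ _
    _ ≤ _ := Subring.closure_mono hsub

/-! ### The morphism `Y → ℙ(M)_k` (any labelling `M ≃ M_d(ι)` of the coordinates) -/

variable {M : Type} (e : M ≃ Md ι d)

omit hd in
/-- Reindexing generating-sections data does not change the generation property of a chart:
the constants and ratios at the chart `a` of `D.reindex e` are those of `D` at `e a`. [folklore] -/
private theorem closure_reindex_eq_top {ι' : Type} (D : GeneratingSections ι' Y) {M' : Type}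
    (e' : M' ≃ ι') (a : M')
    (h : Subring.closure (Set.range (D.cstr f (e' a)) ∪ Set.range (D.ratio (e' a))) = ⊤) :
    Subring.closure (Set.range ((D.reindex e').cstr f a) ∪ Set.range ((D.reindex e').ratio a)) = ⊤ := by
  have hr : Set.range ((D.reindex e').ratio a) = Set.range (D.ratio (e' a)) := by
    change Set.range (fun b ↦ D.ratio (e' a) (e' b)) = _
    exact e'.surjective.range_comp (D.ratio (e' a))
  rw [hr]
  exact h

/-- **The `d`-uple re-embedding `Y → ℙ(M)_k` of `r : Y → ℙ(ι)_k`**, defined by the sections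
`r^*(x^μ)`, `|μ| = d`, the homogeneous coordinates `z_m` of `ℙ(M)_k` being labelled by
`e : M ≃ M_d(ι)` (Hartshorne II Thm. 7.1 (b) for these generating sections of `r^*𝒪(d)`; take
`e = Equiv.refl _`, or `M = Fin N` via `nonempty_fin_equiv_Md`). [cite: Hartshorne1977, II Thm. 7.1 (b)] -/
def veroneseMap : Y ⟶ Proj (grading M k) :=
  ((veroneseData r hd).reindex e).toProj f

/-- `veroneseMap` is a morphism over `k`. [cite: Hartshorne1977, II Thm. 7.1 (b)] -/
theorem veroneseMap_toSpec : veroneseMap f r hd e ≫ toSpec M k = f :=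
  ((veroneseData r hd).reindex e).toProj_toSpec f

/-- `veroneseMap⁻¹D₊(z_a) = Y_{σ_{e a}}`. [cite: Hartshorne1977, II Thm. 7.1 (b)] -/
theorem veroneseMap_preimage_basicOpen (a : M) :
    veroneseMap f r hd e ⁻¹ᵁ Proj.basicOpen (grading M k) (X a) = (veroneseData r hd).U (e a) :=
  ((veroneseData r hd).reindex e).toProj_preimage_basicOpen f a

/-- **`veroneseMap⁻¹D₊(z_a) = r⁻¹D₊(xᵢ)` for the coordinate `a ↔ x_i^d`.** [cite: Hartshorne1977, II Thm. 7.1 (b)] -/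
theorem veroneseMap_preimage_basicOpen_of_eq_single {a : M} {i : ι} (ha : e a = Md.single i) :
    veroneseMap f r hd e ⁻¹ᵁ Proj.basicOpen (grading M k) (X a) =
      r ⁻¹ᵁ Proj.basicOpen (grading ι k) (X i) := by
  rw [veroneseMap_preimage_basicOpen, ha, veroneseData_U_single]

/-- The charts `veroneseMap⁻¹D₊(z_{x_i^d})` cover `Y`. [cite: Hartshorne1977, II Thm. 7.1 (b)] -/
theorem iSup_preimage_basicOpen_single :
    ⨆ i : ι, veroneseMap f r hd e ⁻¹ᵁ Proj.basicOpen (grading M k) (X (e.symm (Md.single i))) = ⊤ := by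
  have h : ∀ i : ι, veroneseMap f r hd e ⁻¹ᵁ Proj.basicOpen (grading M k) (X (e.symm (Md.single i))) =
      (ofHom r).U i := fun i ↦
    (veroneseMap_preimage_basicOpen_of_eq_single f r hd e (e.apply_symm_apply (Md.single i))).trans rfl
  simp_rw [h]
  exact (ofHom r).iSup_U

/-- All the preimages `veroneseMap⁻¹D₊(z_a)` are affine when `r` is affine. [cite: Hartshorne1977, II Thm. 7.1 (b)] -/
theorem isAffineOpen_veroneseMap_preimage_basicOpen [IsAffineHom r] (a : M) :
    IsAffineOpen (veroneseMap f r hd e ⁻¹ᵁ Proj.basicOpen (grading M k) (X a)) := by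
  rw [veroneseMap_preimage_basicOpen]
  exact isAffineOpen_veroneseData_U r hd (e a)

/-- The ratios of `ofHom veroneseMap` are those of `veroneseData` (restricted along
`veroneseMap⁻¹D₊(z_a) = Y_{σ_{e a}}`). [cite: Hartshorne1977, II Thm. 7.1 (b)] -/
theorem homRatio_veroneseMap (a b : M) :
    homRatio (veroneseMap f r hd e) a b =
      rs (veroneseMap_preimage_basicOpen f r hd e a).le ((veroneseData r hd).ratio (e a) (e b)) :=
  ((veroneseData r hd).reindex e).homRatio_toProj f a b

/-- **`veroneseMap^*(z_b/z_a) = r^*(x^μ/x_i^d) = ∏_l r^*(x_l/xᵢ)^{μ l}`** on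
`veroneseMap⁻¹D₊(z_a) = r⁻¹D₊(xᵢ)`, for the coordinates `a ↔ x_i^d`, `b ↔ x^μ`; the right-hand
restriction is along any proof `hW` of `veroneseMap⁻¹D₊(z_a) ≤ r⁻¹D₊(xᵢ)`
(e.g. `(veroneseMap_preimage_basicOpen_of_eq_single … ha).le`). [cite: Hartshorne1977, II Thm. 7.1 (b)] -/
theorem homRatio_veroneseMap_of_eq_single {a b : M} {i : ι} {μ : Md ι d} (ha : e a = Md.single i)
    (hb : e b = μ) (hW : veroneseMap f r hd e ⁻¹ᵁ Proj.basicOpen (grading M k) (X a) ≤ (ofHom r).U i) :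
    homRatio (veroneseMap f r hd e) a b = rs hW ((veroneseSec r μ).val i) := by
  have key : ∀ (m m' : Md ι d), m = Md.single i → m' = μ →
      ∀ {W : Y.Opens} (h : W ≤ (veroneseData r hd).U m) (h' : W ≤ (ofHom r).U i),
        rs h ((veroneseData r hd).ratio m m') = rs h' ((veroneseSec r μ).val i) := by
    rintro _ _ rfl rfl W h h'
    rw [veroneseData_ratio_single, rs_rs]
  rw [homRatio_veroneseMap]
  exact key _ _ ha hb _ hW

/-- In particular **`veroneseMap^*(z_b/z_a) = r^*(x_{i'}/xᵢ)`** for `a ↔ x_i^d`, `b ↔ x_i^{d-1}x_{i'}`.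
[cite: Hartshorne1977, II Thm. 7.1 (b)] -/
theorem homRatio_veroneseMap_of_eq_singleMul {a b : M} {i i' : ι} (ha : e a = Md.single i)
    (hb : e b = Md.singleMul hd i i')
    (hW : veroneseMap f r hd e ⁻¹ᵁ Proj.basicOpen (grading M k) (X a) ≤ (ofHom r).U i) :
    homRatio (veroneseMap f r hd e) a b = rs hW ((ofHom r).ratio i i') := by
  rw [homRatio_veroneseMap_of_eq_single f r hd e ha hb hW, veroneseSec_singleMul_val_self]

/-- **The `d`-uple re-embedding is a closed immersion** when `r` is a closed immersion and `ι` is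
finite: over the charts `D₊(z_a)`, `a ↔ x_i^d`, whose preimages `r⁻¹D₊(xᵢ)` cover `Y`, it is a
closed immersion by Hartshorne II Prop. 7.2 (`r⁻¹D₊(xᵢ)` affine, chart ring map surjective), and
its image is closed, `Y → Spec k` being universally closed (`ℙ(ι)_k → Spec k` is proper) and
`ℙ(M)_k → Spec k` separated. [cite: Hartshorne1977, II Prop. 7.2] -/
theorem isClosedImmersion_veroneseMap [Finite ι] (hr : r ≫ toSpec ι k = f) [IsClosedImmersion r] :
    IsClosedImmersion (veroneseMap f r hd e) := by
  refine isClosedImmersion_of_restrict (veroneseMap f r hd e) (κ := ι)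
    (fun i ↦ Proj.basicOpen (grading M k) (X (e.symm (Md.single i))))
    (iSup_preimage_basicOpen_single f r hd e) (fun i ↦ ?_) ?_
  · refine ((veroneseData r hd).reindex e).isClosedImmersion_toProj_restrict f (e.symm (Md.single i))
      ?_ (((veroneseData r hd).reindex e).sectionsRingHom_surjective_of_closure_eq_top f
        (e.symm (Md.single i)) (closure_reindex_eq_top f _ e _ ?_))
    · rw [reindex_U, e.apply_symm_apply]
      exact isAffineOpen_veroneseData_U r hd (Md.single i)
    · rw [e.apply_symm_apply]
      exact closure_veroneseData_single f r hd hr i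
  · -- the image is closed: `veroneseMap` is universally closed
    have h1 : UniversallyClosed (r ≫ toSpec ι k) := by
      haveI : IsProper (toSpec ι k) := ProjBaseChangeRing.isProper_projToSpec ι k
      infer_instance
    have h2 : UniversallyClosed (veroneseMap f r hd e ≫ toSpec M k) := by
      rw [veroneseMap_toSpec, ← hr]
      exact h1
    have h3 : IsSeparated (toSpec M k) := by
      unfold toSpec
      infer_instance
    have h4 : UniversallyClosed (veroneseMap f r hd e) :=
      .of_comp_of_isSeparated _ (toSpec M k)
    exact (veroneseMap f r hd e).isClosedMap.isClosed_range

end Veronese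

end GeneratingSections

/-! ### The Veronese embedding `v_d : ℙ(ι)_k ↪ ℙ(M_d(ι))_k` -/

namespace Veronese

variable (k : Type u) [CommRing k] (ι : Type) {d : ℕ} (hd : 0 < d) {M : Type}
  (e : M ≃ GeneratingSections.Md ι d)

/-- **The Veronese (`d`-uple) embedding** `v_d : ℙ(ι)_k = Proj k[xᵢ] ⟶ ℙ(M)_k = Proj k[z_m]`,
`M ≃ M_d(ι)` the monomials of degree `d`: the `k`-morphism defined by the generating sections
`x^μ`, `|μ| = d`, of `𝒪(d)` — on homogeneous coordinates `[a] ↦ [a^μ]_μ` (Hartshorne I Ex. 2.12,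
II Ex. 5.13; Görtz–Wedhorn I (13.12)). It is the `d`-uple re-embedding
(`GeneratingSections.veroneseMap`) of the identity of `ℙ(ι)_k`.
[cite: Hartshorne1977, II Ex. 5.13] [cite: GortzWedhorn2020, (13.12)] -/
def veronese : Proj (grading ι k) ⟶ Proj (grading M k) :=
  GeneratingSections.veroneseMap (toSpec ι k) (𝟙 _) hd e

/-- The Veronese map is a morphism over `k`. [cite: Hartshorne1977, II Ex. 5.13] -/
theorem veronese_toSpec : veronese k ι hd e ≫ toSpec M k = toSpec ι k :=
  GeneratingSections.veroneseMap_toSpec _ _ hd e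

/-- **`v_d⁻¹ D₊(z_{x_i^d}) = D₊(xᵢ)`.** [cite: Hartshorne1977, II Ex. 5.13] -/
theorem veronese_preimage_basicOpen_of_eq_single {a : M} {i : ι}
    (ha : e a = GeneratingSections.Md.single i) :
    veronese k ι hd e ⁻¹ᵁ Proj.basicOpen (grading M k) (X a) = Proj.basicOpen (grading ι k) (X i) := by
  rw [veronese, GeneratingSections.veroneseMap_preimage_basicOpen_of_eq_single _ _ hd e ha]
  rfl

/-- **The Veronese embedding is a closed immersion** (`ι` finite): `𝒪(d)` is very ample on
`ℙ(ι)_k` (Hartshorne II Ex. 5.13; Görtz–Wedhorn I Prop. 13.56).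
[cite: Hartshorne1977, II Ex. 5.13] [cite: GortzWedhorn2020, Prop. 13.56] -/
theorem isClosedImmersion_veronese [Finite ι] : IsClosedImmersion (veronese k ι hd e) :=
  GeneratingSections.isClosedImmersion_veroneseMap _ _ hd e (Category.id_comp _)

end Veronese

end Literature.AlgebraicGeometry.Motives

end
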